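import Literature.Geometry.Lorentzian.KerrSliceBall
import Mathlib.Analysis.Calculus.InverseFunctionTheorem.ApproximatesLinearOn
import Mathlib.Analysis.SpecificLimits.Normed
import Mathlib.Analysis.Calculus.ContDiff.Operations
import Mathlib.Analysis.Normed.Module.FiniteDimension
import HarnessLib

/-!
# `BulkKerrCaptureC2` — spin transport I: unit-mass slices as spheroid exteriors; perturbations of the identity

Crux `stmt-FinalStateConjecture-14985`
(`Summit.FinalStateConjecture.FinalStateConjecture.Theses.PhaseMixingCapture.BulkKerrCaptureC2`, rank 4 of
`route-FinalStateConjecture-PhaseMixingCapture`). Helper file (`--supports`), closes nothing by itself.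

First file of the SPIN TRANSPORT package, whose headline (last file) is: in the weight window `δ < 1/2` the
crux follows from POINTWISE-in-the-spin `C²` capture (one basin `ε` per spin, exponents `(s, δ)` per compact
spin range) — the local uniformity of `ε` in the spin that the normal form
`NormalForm.bulkKerrCaptureC2_iff_locallyUniform` isolates as "the only content of the crux beyond the pointwise
theorem" is automatic. The mechanism compares data over the unit-mass Kerr–Schild slices of two nearby spins
along an explicit identification of the slices; this file supplies the two elementary ingredients.

* `mem_slice_one_iff` — **the unit-mass slice is the exterior of an oblate spheroid**:
  `y ∈ Kerr.slice c 1 ↔ 1 < (y₀² + y₁²)/(1 + c²) + y₂²` for `|c| < 1` (O'Neill 1995, Ch. 2, §2.1: the level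
  set `{r = 1}` of the Kerr–Schild radius; read off `Kerr.mem_slice_rPlus_iff` at the mass `(1 + c²)/2`, whose
  outer horizon radius is `1`); hence `‖y‖ > 1` on the slice and `‖y‖² ≥ 2 ⇒ y ∈` every such slice.
* `exists_perturbation_package` — for a smooth compactly supported field `V : E3 → E3` and `|μ − 1| ≤ μ₀(V)`
  the perturbed identity `T_μ y = y + (μ − 1) V y` underlies a homeomorphism of `E3` with smooth inverse, with
  `‖DT_μ − 1‖ ≤ 1/2` and Jacobian determinant `≥ 1/2` in absolute value (Lipschitz inverse function theorem,
  `ApproximatesLinearOn.toHomeomorph`, `Homeomorph.contDiff_symm`, continuity of `det`).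

Everything is proved; no definitions, no named facts.
-/

-- the doubled `FinalStateConjecture.FinalStateConjecture` path component trips dupNamespace
set_option linter.dupNamespace false

noncomputable section

open Set Filter Function Metric Topology TopologicalSpace
open scoped Manifold ContDiff Topology NNReal
open Literature.Geometry.Lorentzian

namespace Summit.FinalStateConjecture.FinalStateConjecture.Theorems.BulkKerrCaptureC2.SpinTransport

/-! ## §1 The unit-mass slice is the exterior of a spheroid -/

/-- For `|c| < 1` the mass `M_c = (1 + c²)/2` is sub-extremal for the spin `c` and has outer horizon radius
`r₊(M_c, c) = 1`. [folklore] -/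
theorem rPlus_half_one_add_sq {c : ℝ} (hc : |c| < 1) :
    Kerr.IsSubextremal ((1 + c ^ 2) / 2) c ∧ Kerr.rPlus ((1 + c ^ 2) / 2) c = 1 := by
  have hc2 : c ^ 2 < 1 := by
    have h := abs_nonneg c
    have : |c| ^ 2 < 1 := by nlinarith
    rwa [sq_abs] at this
  have hsub : Kerr.IsSubextremal ((1 + c ^ 2) / 2) c := by
    unfold Kerr.IsSubextremal
    nlinarith [sq_abs c, sq_nonneg (1 - |c|), abs_nonneg c]
  refine ⟨hsub, ?_⟩
  unfold Kerr.rPlus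
  have e : ((1 + c ^ 2) / 2) ^ 2 - c ^ 2 = ((1 - c ^ 2) / 2) ^ 2 := by ring
  rw [e, Real.sqrt_sq (by linarith)]
  ring

/-- **The unit-mass Kerr–Schild slice of spin `c`, `|c| < 1`, is the exterior of the solid oblate spheroid of
semi-axes `√(1 + c²), √(1 + c²), 1`**: `y ∈ Kerr.slice c 1 ↔ 1 < (y₀² + y₁²)/(1 + c²) + y₂²` (the level set
`{r = 1}` of the Kerr–Schild radius is that spheroid; O'Neill 1995, Ch. 2, §2.1, via `Kerr.mem_slice_rPlus_iff`
at the mass `(1 + c²)/2`). [cite: ONeill1995, Ch. 2 §2.1] -/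
theorem mem_slice_one_iff {c : ℝ} (hc : |c| < 1) (y : E3) :
    y ∈ Kerr.slice c 1 ↔ 1 < (y 0 ^ 2 + y 1 ^ 2) / (1 + c ^ 2) + y 2 ^ 2 := by
  obtain ⟨hsub, hr⟩ := rPlus_half_one_add_sq hc
  have h := Kerr.mem_slice_rPlus_iff hsub (y := y)
  rw [hr] at h
  rw [h, Kerr.horizonQuadric, hr]
  norm_num [add_comm]

/-- Points of the closed far region `‖y‖ ≥ √2` lie in every unit-mass slice of spin `|c| < 1` (the solid
spheroid is contained in the open ball of radius `√(1 + c²) ≤ √2`). [folklore] -/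
theorem mem_slice_one_of_two_le_norm_sq {c : ℝ} (hc : |c| < 1) {y : E3} (hy : 2 ≤ ‖y‖ ^ 2) :
    y ∈ Kerr.slice c 1 := by
  rw [mem_slice_one_iff hc]
  have hn : ‖y‖ ^ 2 = y 0 ^ 2 + y 1 ^ 2 + y 2 ^ 2 := by
    rw [EuclideanSpace.norm_sq_eq, Fin.sum_univ_three]
    simp only [Real.norm_eq_abs, sq_abs]
  have hc2 : c ^ 2 < 1 := by
    have : |c| ^ 2 < 1 := by nlinarith [abs_nonneg c]
    rwa [sq_abs] at this
  have hpos : 0 < 1 + c ^ 2 := by positivity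
  rw [div_add' _ _ _ hpos.ne', lt_div_iff₀ hpos]
  nlinarith [sq_nonneg (y 2), sq_nonneg (y 0), sq_nonneg (y 1)]

/-- Points of a unit-mass slice of spin `|c| < 1` have `‖y‖ > … ≥`: the solid spheroid contains the closed
unit ball, so `1 < ‖y‖²` on the slice. [folklore] -/
theorem one_lt_norm_sq_of_mem_slice_one {c : ℝ} (hc : |c| < 1) {y : E3} (hy : y ∈ Kerr.slice c 1) :
    1 < ‖y‖ ^ 2 := by
  rw [mem_slice_one_iff hc] at hy
  have hn : ‖y‖ ^ 2 = y 0 ^ 2 + y 1 ^ 2 + y 2 ^ 2 := by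
    rw [EuclideanSpace.norm_sq_eq, Fin.sum_univ_three]
    simp only [Real.norm_eq_abs, sq_abs]
  have hpos : 0 < 1 + c ^ 2 := by positivity
  have hle : (y 0 ^ 2 + y 1 ^ 2) / (1 + c ^ 2) ≤ y 0 ^ 2 + y 1 ^ 2 :=
    div_le_self (by positivity) (by nlinarith [sq_nonneg c])
  linarith

/-! ## §2 Perturbations of the identity by a compactly supported field -/

section Perturbation

variable {V : E3 → E3}

/-- A `C¹` field with compact support has a global Lipschitz constant, which also bounds its derivative.
[folklore] -/
theorem exists_lipschitz_of_hasCompactSupport (hV : ContDiff ℝ 1 V) (hVc : HasCompactSupport V) :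
    ∃ L : ℝ≥0, LipschitzWith L V ∧ ∀ y, ‖fderiv ℝ V y‖ ≤ L := by
  have hc : Continuous fun y ↦ ‖fderiv ℝ V y‖ := (hV.continuous_fderiv one_ne_zero).norm
  have hcs : HasCompactSupport fun y ↦ ‖fderiv ℝ V y‖ := (hVc.fderiv (𝕜 := ℝ)).norm
  obtain ⟨C, hC⟩ := hc.bddAbove_range_of_hasCompactSupport hcs
  have hC' : ∀ y, ‖fderiv ℝ V y‖ ≤ max C 0 := fun y ↦ (hC ⟨y, rfl⟩).trans (le_max_left _ _)
  refine ⟨⟨max C 0, le_max_right _ _⟩, ?_, fun y ↦ hC' y⟩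
  refine lipschitzWith_of_nnnorm_fderiv_le (hV.differentiable one_ne_zero) fun y ↦ ?_
  rw [← NNReal.coe_le_coe, coe_nnnorm]
  exact hC' y

/-- A continuous field with compact support is bounded. [folklore] -/
theorem exists_bound_of_hasCompactSupport (hV : Continuous V) (hVc : HasCompactSupport V) :
    ∃ A : ℝ, 0 ≤ A ∧ ∀ y, ‖V y‖ ≤ A := by
  obtain ⟨C, hC⟩ := hV.norm.bddAbove_range_of_hasCompactSupport hVc.norm
  exact ⟨max C 0, le_max_right _ _, fun y ↦ (hC ⟨y, rfl⟩).trans (le_max_left _ _)⟩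

/-- The perturbed identity `T_μ y = y + (μ − 1) V y` has derivative `1 + (μ − 1) DV(y)`. [folklore] -/
theorem hasFDerivAt_perturbation (hV : ContDiff ℝ 1 V) (μ : ℝ) (y : E3) :
    HasFDerivAt (fun y ↦ y + (μ - 1) • V y)
      (ContinuousLinearMap.id ℝ E3 + (μ - 1) • fderiv ℝ V y) y :=
  (hasFDerivAt_id y).add (((hV.differentiable one_ne_zero) y).hasFDerivAt.const_smul (μ - 1))

/-- The derivative of the perturbed identity, as a `fderiv`. [folklore] -/
theorem fderiv_perturbation (hV : ContDiff ℝ 1 V) (μ : ℝ) (y : E3) :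
    fderiv ℝ (fun y ↦ y + (μ - 1) • V y) y = ContinuousLinearMap.id ℝ E3 + (μ - 1) • fderiv ℝ V y :=
  (hasFDerivAt_perturbation hV μ y).fderiv

/-- The perturbed identity is smooth when the field is. [folklore] -/
theorem contDiff_perturbation (hV : ContDiff ℝ ∞ V) (μ : ℝ) :
    ContDiff ℝ ∞ fun y ↦ y + (μ - 1) • V y :=
  contDiff_id.add (hV.const_smul (μ - 1))

/-- The perturbed identity is jointly smooth in `(μ, y)`. [folklore] -/
theorem contDiff_perturbation₂ (hV : ContDiff ℝ ∞ V) :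
    ContDiff ℝ ∞ fun p : ℝ × E3 ↦ p.2 + (p.1 - 1) • V p.2 :=
  contDiff_snd.add ((contDiff_fst.sub contDiff_const).smul (hV.comp contDiff_snd))

/-- **Determinants near the identity**: there is `τ > 0` with `det(1 + S) ≥ 1/2` whenever `‖S‖ ≤ τ`
(continuity of the determinant on `E3 →L E3`). [folklore] -/
theorem exists_det_one_add_ge_half :
    ∃ τ : ℝ, 0 < τ ∧ ∀ S : E3 →L[ℝ] E3, ‖S‖ ≤ τ → (1 / 2 : ℝ) ≤ |(ContinuousLinearMap.id ℝ E3 + S).det| := by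
  have hc : ContinuousAt (fun f : E3 →L[ℝ] E3 ↦ f.det) (ContinuousLinearMap.id ℝ E3) :=
    ContinuousLinearMap.continuous_det.continuousAt
  rw [Metric.continuousAt_iff] at hc
  obtain ⟨δ, hδ, h⟩ := hc (1 / 2) one_half_pos
  refine ⟨δ / 2, half_pos hδ, fun S hS ↦ ?_⟩
  have hd : dist (ContinuousLinearMap.id ℝ E3 + S) (ContinuousLinearMap.id ℝ E3) < δ := by
    rw [dist_eq_norm, add_sub_cancel_left]
    linarith
  have h1 := h hd
  rw [Real.dist_eq, show (ContinuousLinearMap.id ℝ E3).det = 1 from LinearMap.det_id] at h1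
  have h2 := abs_sub_abs_le_abs_sub (1 : ℝ) ((ContinuousLinearMap.id ℝ E3 + S).det)
  rw [abs_sub_comm] at h1
  rw [abs_one] at h2
  linarith

/-- **The perturbation package.** For a smooth compactly supported field `V` there is `μ₀ > 0` such that for
`|μ − 1| ≤ μ₀` the map `T_μ y = y + (μ − 1) V y` is (the underlying map of) a homeomorphism of `E3` with smooth
inverse, its derivative is within `1/2` of the identity and its Jacobian determinant is at least `1/2` in
absolute value (inverse function theorem for Lipschitz perturbations of the identity,
`ApproximatesLinearOn.toHomeomorph`, `Homeomorph.contDiff_symm`). [folklore] -/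
theorem exists_perturbation_package (hV : ContDiff ℝ ∞ V) (hVc : HasCompactSupport V) :
    ∃ μ₀ : ℝ, 0 < μ₀ ∧ μ₀ ≤ 1 ∧ ∀ μ : ℝ, |μ - 1| ≤ μ₀ →
      ∃ H : E3 ≃ₜ E3, (∀ y, H y = y + (μ - 1) • V y) ∧ ContDiff ℝ ∞ (H.symm : E3 → E3) ∧
        (∀ y, ‖fderiv ℝ (fun y ↦ y + (μ - 1) • V y) y - ContinuousLinearMap.id ℝ E3‖ ≤ 1 / 2) ∧
        ∀ y, (1 / 2 : ℝ) ≤ |(fderiv ℝ (fun y ↦ y + (μ - 1) • V y) y).det| := by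
  obtain ⟨L, hL, hDL⟩ := exists_lipschitz_of_hasCompactSupport (contDiff_infty.1 hV 1) hVc
  obtain ⟨τ, hτ, hdet⟩ := exists_det_one_add_ge_half
  set μ₀ : ℝ := min 1 (min (1 / 2) τ / (L + 1)) with hμ₀
  have hL0 : (0 : ℝ) ≤ L := L.2
  have hμ₀pos : 0 < μ₀ := lt_min one_pos (div_pos (lt_min one_half_pos hτ) (by linarith))
  have hμ₀L : μ₀ * (L + 1) ≤ min (1 / 2) τ := by
    have h1 : μ₀ ≤ min (1 / 2) τ / (L + 1) := min_le_right _ _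
    rwa [le_div_iff₀ (by linarith)] at h1
  refine ⟨μ₀, hμ₀pos, min_le_left _ _, fun μ hμ ↦ ?_⟩
  -- the derivative perturbation `(μ - 1) DV` has norm `≤ |μ - 1| L ≤ min (1/2) τ`
  have hS : ∀ y, ‖(μ - 1) • fderiv ℝ V y‖ ≤ min (1 / 2) τ := fun y ↦ by
    rw [norm_smul, Real.norm_eq_abs]
    calc |μ - 1| * ‖fderiv ℝ V y‖ ≤ μ₀ * L := mul_le_mul hμ (hDL y) (norm_nonneg _) hμ₀pos.le
      _ ≤ μ₀ * (L + 1) := by nlinarith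
      _ ≤ min (1 / 2) τ := hμ₀L
  -- `T_μ` approximates the identity with Lipschitz constant `|μ - 1| L < 1`
  set c : ℝ≥0 := ‖μ - 1‖₊ * L with hc
  have hcR : (c : ℝ) = |μ - 1| * L := by rw [hc, NNReal.coe_mul, coe_nnnorm, Real.norm_eq_abs]
  have happrox : ApproximatesLinearOn (fun y ↦ y + (μ - 1) • V y)
      ((ContinuousLinearEquiv.refl ℝ E3 : E3 ≃L[ℝ] E3) : E3 →L[ℝ] E3) univ c := by
    intro x _ y _
    rw [ContinuousLinearEquiv.coe_refl, ContinuousLinearMap.id_apply]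
    have e : x + (μ - 1) • V x - (y + (μ - 1) • V y) - (x - y) = (μ - 1) • (V x - V y) := by
      rw [smul_sub]; abel
    rw [e, norm_smul, Real.norm_eq_abs, hcR, mul_assoc]
    exact mul_le_mul_of_nonneg_left (hL.norm_sub_le x y) (abs_nonneg _)
  have hclt : Subsingleton E3 ∨ c < ‖((ContinuousLinearEquiv.refl ℝ E3).symm : E3 →L[ℝ] E3)‖₊⁻¹ := by
    right
    rw [ContinuousLinearEquiv.refl_symm, ContinuousLinearEquiv.coe_refl, ContinuousLinearMap.nnnorm_id,
      inv_one, ← NNReal.coe_lt_coe, hcR, NNReal.coe_one]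
    calc |μ - 1| * L ≤ μ₀ * L := mul_le_mul_of_nonneg_right hμ hL0
      _ ≤ μ₀ * (L + 1) := by nlinarith
      _ ≤ min (1 / 2) τ := hμ₀L
      _ ≤ 1 / 2 := min_le_left _ _
      _ < 1 := one_half_lt_one
  set H : E3 ≃ₜ E3 := happrox.toHomeomorph _ hclt with hH
  have hHcoe : ∀ y, H y = y + (μ - 1) • V y := fun y ↦ rfl
  -- the derivative is an isomorphism at every point
  have hunit : ∀ y, ‖-((μ - 1) • fderiv ℝ V y)‖ < 1 := fun y ↦ by
    rw [norm_neg]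
    exact (hS y).trans_lt ((min_le_left _ _).trans_lt one_half_lt_one)
  set Φ' : E3 → E3 ≃L[ℝ] E3 := fun y ↦
    ContinuousLinearEquiv.unitsEquiv ℝ E3 (Units.oneSub _ (hunit y)) with hΦ'
  have hderiv : ∀ y, HasFDerivAt H (Φ' y : E3 →L[ℝ] E3) y := by
    intro y
    have e : (Φ' y : E3 →L[ℝ] E3) = ContinuousLinearMap.id ℝ E3 + (μ - 1) • fderiv ℝ V y := by
      ext v
      rw [ContinuousLinearEquiv.coe_coe, hΦ', ContinuousLinearEquiv.unitsEquiv_apply, Units.val_oneSub,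
        sub_neg_eq_add]
      rfl
    rw [e]
    exact hasFDerivAt_perturbation (contDiff_infty.1 hV 1) μ y
  have hsymm : ContDiff ℝ ∞ (H.symm : E3 → E3) :=
    H.contDiff_symm hderiv (contDiff_perturbation hV μ)
  refine ⟨H, hHcoe, hsymm, fun y ↦ ?_, fun y ↦ ?_⟩
  · rw [fderiv_perturbation (contDiff_infty.1 hV 1), add_sub_cancel_left]
    exact (hS y).trans (min_le_left _ _)
  · rw [fderiv_perturbation (contDiff_infty.1 hV 1)]
    exact hdet _ ((hS y).trans (min_le_right _ _))

/-- Off the support of the field the perturbed identity is the identity. [folklore] -/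
theorem perturbation_eq_self_of_notMem {y : E3} (hy : y ∉ Function.support V) (μ : ℝ) :
    y + (μ - 1) • V y = y := by
  rw [Function.notMem_support.1 hy, smul_zero, add_zero]

/-- The perturbed identity moves points by at most `|μ − 1| sup ‖V‖`. [folklore] -/
theorem norm_perturbation_sub_le {A : ℝ} (hA : ∀ y, ‖V y‖ ≤ A) (μ : ℝ) (y : E3) :
    ‖y + (μ - 1) • V y - y‖ ≤ |μ - 1| * A := by
  rw [add_sub_cancel_left, norm_smul, Real.norm_eq_abs]
  exact mul_le_mul_of_nonneg_left (hA y) (abs_nonneg _)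

end Perturbation

/-- **Registered sub-goal `stub_mem_slice_one_iff`** (crux item stmt-FinalStateConjecture-14985, SPIN TRANSPORT
package): the unit-mass Kerr–Schild slice of spin `|c| < 1` is the exterior of the solid spheroid
`(y₀² + y₁²)/(1 + c²) + y₂² ≤ 1` (closed form of `mem_slice_one_iff`). [cite: ONeill1995, Ch. 2 §2.1] -/
theorem stub_mem_slice_one_iff : ∀ (c : ℝ), |c| < 1 → ∀ y : E3, y ∈ Kerr.slice c 1 ↔ 1 < (y 0 ^ 2 + y 1 ^ 2) / (1 + c ^ 2) + y 2 ^ 2 :=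
  fun _ hc y ↦ mem_slice_one_iff hc y

end Summit.FinalStateConjecture.FinalStateConjecture.Theorems.BulkKerrCaptureC2.SpinTransport

end
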